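import Mathlib

/-!
# Rotation identity for the edge-twin mass (crux `HyperoctahedralThreshold`, refutation line, lead c3)

For three involutions `μ c` on `Fin n` ("colours"), a colour word `z : List (Fin 3)` acts on the right by
`x · z := z.foldl (fun v c => μ c v) x` (the convention of the line's stubs).  Fix a colour `d` and a
length `m`.  For a cyclically reduced word `z` of length `m` (`List.IsChain (· ≠ ·) (z ++ z)`) and
`t ≤ m`, the **`t`-partner** of a point `x` is `x · z_[t] · d · z_[t]⁻¹` (walk `t` steps along `z`, cross
the `d`-edge, walk back), i.e. `(z.take t).reverse.foldl _ (μ d ((z.take t).foldl _ x))`.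

`partnerMass_eq_edgeTwinMass`: summed over all cyclically reduced words of length `m`,
  `#{(z, x) : x ∈ Fix z, (t-partner of x) ∈ Fix z} = #{(z, x) : x ∈ Fix z, x·d ∈ Fix z}`  for every `t ≤ m`,
because `(z, x) ↦ (z.rotate t, x · z_[t])` is a bijection of based closed walks carrying one condition to the
other (`foldl_rotate_fixed_iff`).  Summing over `t < m` (`sum_partnerMass_eq`): the "touching degree"
`deg_z(x) = #{t < m : t-partner ∈ Fix z}` has total mass `m · E_d` (crux NOTES §15.3 (R1)); so an edge-twin
rate `E_d ≥ T_m / K` forces the closed-walk mass onto words with `≳ m / K` fixed points whose trajectories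
pairwise touch along `d`-edges.  Pure finite combinatorics: no hypothesis on `n`, only `μ c * μ c = 1`.
No definitions are introduced; the sums are written out over
`((univ : Finset (List.Vector (Fin 3) m)).image toList).filter (IsChain (· ≠ ·) (z ++ z))`.
-/

set_option linter.dupNamespace false

namespace Summit.MatrixMultiplication.MatrixMultiplication.Theorems.HyperoctahedralThreshold.Rotation

open Finset

variable {n : ℕ}

/-- The action of a concatenation (restated `List.foldl_append` in the line's convention). -/
theorem foldl_act_append (μ : Fin 3 → Equiv.Perm (Fin n)) (x : Fin n) (u w : List (Fin 3)) :
    (u ++ w).foldl (fun v c => μ c v) x = w.foldl (fun v c => μ c v) (u.foldl (fun v c => μ c v) x) := by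
  simp [List.foldl_append]

/-- Walking back along the reversed word undoes the walk (letters are involutions). -/
theorem foldl_act_reverse (μ : Fin 3 → Equiv.Perm (Fin n)) (hμ : ∀ c, μ c * μ c = 1) :
    ∀ (w : List (Fin 3)) (x : Fin n),
      w.reverse.foldl (fun v c => μ c v) (w.foldl (fun v c => μ c v) x) = x := by
  intro w
  induction w with
  | nil => intro x; rfl
  | cons c w ih =>
    intro x
    rw [List.foldl_cons, List.reverse_cons, foldl_act_append, ih]
    show μ c (μ c x) = x
    have : (μ c * μ c) x = x := by rw [hμ c]; rfl
    simpa using this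

/-- Walking along the reversed word and then forward is the identity. -/
theorem foldl_reverse_act (μ : Fin 3 → Equiv.Perm (Fin n)) (hμ : ∀ c, μ c * μ c = 1)
    (w : List (Fin 3)) (x : Fin n) :
    w.foldl (fun v c => μ c v) (w.reverse.foldl (fun v c => μ c v) x) = x := by
  simpa using foldl_act_reverse μ hμ w.reverse x

/-- The action of a fixed word is injective. -/
theorem foldl_act_injective (μ : Fin 3 → Equiv.Perm (Fin n)) (hμ : ∀ c, μ c * μ c = 1)
    (w : List (Fin 3)) : Function.Injective (fun x => w.foldl (fun v c => μ c v) x) := by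
  intro x y h
  have := congrArg (fun v => w.reverse.foldl (fun v c => μ c v) v) h
  simpa [foldl_act_reverse μ hμ] using this

/-- Membership in the `Finset` of all colour words of length `m`. -/
theorem mem_words {m : ℕ} {z : List (Fin 3)} :
    z ∈ (Finset.univ : Finset (List.Vector (Fin 3) m)).image (fun v => v.toList) ↔ z.length = m := by
  constructor
  · intro h
    obtain ⟨v, -, rfl⟩ := Finset.mem_image.1 h
    exact v.toList_length
  · intro h
    exact Finset.mem_image.2 ⟨⟨z, h⟩, Finset.mem_univ _, rfl⟩

/-- Membership in the `Finset` of cyclically reduced colour words of length `m`. -/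
theorem mem_cycWords {m : ℕ} {z : List (Fin 3)} :
    z ∈ ((Finset.univ : Finset (List.Vector (Fin 3) m)).image (fun v => v.toList)).filter
        (fun z => List.IsChain (· ≠ ·) (z ++ z)) ↔
      z.length = m ∧ List.IsChain (· ≠ ·) (z ++ z) := by
  rw [Finset.mem_filter, mem_words]

/-- Cyclic reducedness is invariant under rotation. -/
theorem isChain_rotate_append_rotate {R : Fin 3 → Fin 3 → Prop} {z : List (Fin 3)}
    (hz : List.IsChain R (z ++ z)) (t : ℕ) : List.IsChain R (z.rotate t ++ z.rotate t) := by
  rcases eq_or_ne z [] with rfl | hne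
  · simp
  have hlen : 0 < z.length := List.length_pos_of_ne_nil hne
  rw [← List.rotate_mod z t]
  set s := t % z.length with hs
  have hsl : s ≤ z.length := (Nat.mod_lt t hlen).le
  rw [List.rotate_eq_drop_append_take hsl]
  set A := z.take s
  set B := z.drop s
  have hzAB : z = A ++ B := (List.take_append_drop s z).symm
  rw [hzAB] at hz
  have h1 : List.IsChain R (A ++ B) := hz.left_of_append
  have hA : List.IsChain R A := h1.left_of_append
  have hB : List.IsChain R B := h1.right_of_append
  have hAB : ∀ x ∈ A.getLast?, ∀ y ∈ B.head?, R x y := (List.isChain_append.1 h1).2.2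
  have hBA : ∀ x ∈ B.getLast?, ∀ y ∈ A.head?, R x y := by
    intro x hx y hy
    have hz' := hz
    rw [List.append_assoc] at hz'
    have h2 : List.IsChain R (B ++ (A ++ B)) := hz'.right_of_append
    have h3 := (List.isChain_append.1 h2).2.2
    have hy' : y ∈ (A ++ B).head? := by
      rcases A with _ | ⟨a, A'⟩
      · simp at hy
      · simpa using hy
    exact h3 x hx y hy'
  have hBA' : List.IsChain R (B ++ A) := List.IsChain.append hB hA hBA
  refine List.IsChain.append hBA' hBA' ?_
  intro x hx y hy
  rcases eq_or_ne A [] with hA0 | hA0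
  · rw [hA0] at hx hy hz
    simp only [List.append_nil, List.nil_append] at hx hy hz
    rcases eq_or_ne B [] with hB0 | hB0
    · rw [hB0] at hx; simp at hx
    · exact (List.isChain_append.1 hz).2.2 x hx y hy
  · rcases eq_or_ne B [] with hB0 | hB0
    · rw [hB0] at hx hy hz
      simp only [List.nil_append, List.append_nil] at hx hy hz
      exact (List.isChain_append.1 hz).2.2 x hx y hy
    · have hx' : x ∈ A.getLast? := by
        rw [List.getLast?_append] at hx
        rcases hA : A.getLast? with _ | a
        · exact absurd (List.getLast?_eq_none_iff.1 hA) hA0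
        · rw [hA] at hx; simpa using hx
      have hy' : y ∈ B.head? := by
        rw [List.head?_append] at hy
        rcases hB : B.head? with _ | b
        · exact absurd (List.head?_eq_none_iff.1 hB) hB0
        · rw [hB] at hy; simpa using hy
      exact hAB x hx' y hy'

/-- Rotation maps cyclically reduced words of length `m` to cyclically reduced words of length `m`. -/
theorem rotate_mem_cycWords {m : ℕ} {z : List (Fin 3)}
    (hz : z ∈ ((Finset.univ : Finset (List.Vector (Fin 3) m)).image (fun v => v.toList)).filter
        (fun z => List.IsChain (· ≠ ·) (z ++ z))) (t : ℕ) :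
    z.rotate t ∈ ((Finset.univ : Finset (List.Vector (Fin 3) m)).image (fun v => v.toList)).filter
        (fun z => List.IsChain (· ≠ ·) (z ++ z)) := by
  rw [mem_cycWords] at hz ⊢
  exact ⟨by rw [List.length_rotate, hz.1], isChain_rotate_append_rotate hz.2 t⟩

/-- Closedness transports along the walk: `x ∈ Fix z ↔ x · z_[t] ∈ Fix (z.rotate t)`. -/
theorem foldl_rotate_fixed_iff (μ : Fin 3 → Equiv.Perm (Fin n)) (hμ : ∀ c, μ c * μ c = 1)
    {z : List (Fin 3)} {t : ℕ} (ht : t ≤ z.length) (x : Fin n) :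
    (z.rotate t).foldl (fun v c => μ c v) ((z.take t).foldl (fun v c => μ c v) x) =
        (z.take t).foldl (fun v c => μ c v) x ↔
      z.foldl (fun v c => μ c v) x = x := by
  rw [List.rotate_eq_drop_append_take ht, foldl_act_append,
    ← foldl_act_append μ x (z.take t) (z.drop t), List.take_append_drop]
  exact (foldl_act_injective μ hμ (z.take t)).eq_iff

/-- **Rotation identity** (crux NOTES §15.3 (R1)): for `t ≤ m`, the number of based closed walks
`(z, x)` (cyclically reduced `z` of length `m`, `x · z = x`) whose `t`-partner
`x · z_[t] · d · z_[t]⁻¹` is also fixed by `z` equals the number whose `d`-neighbour `μ d x` is fixed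
(the **edge-twin mass** `E_d`). -/
theorem partnerMass_eq_edgeTwinMass (μ : Fin 3 → Equiv.Perm (Fin n)) (hμ : ∀ c, μ c * μ c = 1)
    (d : Fin 3) {m t : ℕ} (ht : t ≤ m) :
    ∑ z ∈ ((Finset.univ : Finset (List.Vector (Fin 3) m)).image (fun v => v.toList)).filter
        (fun z => List.IsChain (· ≠ ·) (z ++ z)),
      ((Finset.univ : Finset (Fin n)).filter (fun x =>
        z.foldl (fun v c => μ c v) x = x ∧
        z.foldl (fun v c => μ c v)
            ((z.take t).reverse.foldl (fun v c => μ c v) (μ d ((z.take t).foldl (fun v c => μ c v) x))) =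
          (z.take t).reverse.foldl (fun v c => μ c v) (μ d ((z.take t).foldl (fun v c => μ c v) x)))).card =
    ∑ z ∈ ((Finset.univ : Finset (List.Vector (Fin 3) m)).image (fun v => v.toList)).filter
        (fun z => List.IsChain (· ≠ ·) (z ++ z)),
      ((Finset.univ : Finset (Fin n)).filter (fun x =>
        z.foldl (fun v c => μ c v) x = x ∧ z.foldl (fun v c => μ c v) (μ d x) = μ d x)).card := by
  refine Finset.sum_nbij' (fun z => z.rotate t) (fun z => z.rotate (m - t)) ?_ ?_ ?_ ?_ ?_
  · intro z hz; exact rotate_mem_cycWords hz t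
  · intro z hz; exact rotate_mem_cycWords hz (m - t)
  · intro z hz
    have hl : z.length = m := (mem_cycWords.1 hz).1
    show (z.rotate t).rotate (m - t) = z
    rw [List.rotate_rotate, Nat.add_sub_cancel' ht, ← hl, List.rotate_length]
  · intro z hz
    have hl : z.length = m := (mem_cycWords.1 hz).1
    show (z.rotate (m - t)).rotate t = z
    rw [List.rotate_rotate, Nat.sub_add_cancel ht, ← hl, List.rotate_length]
  · intro z hz
    have hl : z.length = m := (mem_cycWords.1 hz).1
    have htz : t ≤ z.length := hl ▸ ht
    -- inner bijection `x ↦ x · z_[t]`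
    refine Finset.card_nbij' (fun x => (z.take t).foldl (fun v c => μ c v) x)
      (fun y => (z.take t).reverse.foldl (fun v c => μ c v) y) ?_ ?_ ?_ ?_
    · intro x hx
      obtain ⟨-, hx1, hx2⟩ := Finset.mem_filter.1 hx
      refine Finset.mem_filter.2 ⟨Finset.mem_univ _, (foldl_rotate_fixed_iff μ hμ htz x).2 hx1, ?_⟩
      have h2 := (foldl_rotate_fixed_iff μ hμ htz
        ((z.take t).reverse.foldl (fun v c => μ c v) (μ d ((z.take t).foldl (fun v c => μ c v) x)))).2 hx2
      rw [foldl_reverse_act μ hμ (z.take t) (μ d ((z.take t).foldl (fun v c => μ c v) x))] at h2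
      exact h2
    · intro y hy
      obtain ⟨-, hy1, hy2⟩ := Finset.mem_filter.1 hy
      refine Finset.mem_filter.2 ⟨Finset.mem_univ _, ?_, ?_⟩
      · rw [← foldl_rotate_fixed_iff μ hμ htz, foldl_reverse_act μ hμ (z.take t) y]
        exact hy1
      · rw [foldl_reverse_act μ hμ (z.take t) y, ← foldl_rotate_fixed_iff μ hμ htz,
          foldl_reverse_act μ hμ (z.take t) (μ d y)]
        exact hy2
    · intro x _; exact foldl_act_reverse μ hμ _ _
    · intro y _; exact foldl_reverse_act μ hμ _ _

/-- **Total touching degree** (crux NOTES §15.3 (R1), summed form): `Σ_{t < m} (t-partner mass) = m · E_d`. -/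
theorem sum_partnerMass_eq (μ : Fin 3 → Equiv.Perm (Fin n)) (hμ : ∀ c, μ c * μ c = 1) (d : Fin 3)
    (m : ℕ) :
    ∑ t ∈ Finset.range m,
      ∑ z ∈ ((Finset.univ : Finset (List.Vector (Fin 3) m)).image (fun v => v.toList)).filter
          (fun z => List.IsChain (· ≠ ·) (z ++ z)),
        ((Finset.univ : Finset (Fin n)).filter (fun x =>
          z.foldl (fun v c => μ c v) x = x ∧
          z.foldl (fun v c => μ c v)
              ((z.take t).reverse.foldl (fun v c => μ c v) (μ d ((z.take t).foldl (fun v c => μ c v) x))) =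
            (z.take t).reverse.foldl (fun v c => μ c v) (μ d ((z.take t).foldl (fun v c => μ c v) x)))).card =
    m * ∑ z ∈ ((Finset.univ : Finset (List.Vector (Fin 3) m)).image (fun v => v.toList)).filter
          (fun z => List.IsChain (· ≠ ·) (z ++ z)),
        ((Finset.univ : Finset (Fin n)).filter (fun x =>
          z.foldl (fun v c => μ c v) x = x ∧ z.foldl (fun v c => μ c v) (μ d x) = μ d x)).card := by
  rw [Finset.sum_congr rfl (fun t ht => partnerMass_eq_edgeTwinMass μ hμ d (Finset.mem_range.1 ht).le),
    Finset.sum_const, Finset.card_range, smul_eq_mul]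

/-- **Registered form** (`stub_rotationIdentity`, a `--supports` sub-goal of crux
`stmt-MatrixMultiplication-10883`): the rotation identity `partnerMass_eq_edgeTwinMass`, fully quantified. -/
theorem stub_rotationIdentity : ∀ (n : ℕ) (μ : Fin 3 → Equiv.Perm (Fin n)), (∀ c, μ c * μ c = 1) → ∀ (d : Fin 3) (m t : ℕ), t ≤ m → (∑ z ∈ ((Finset.univ : Finset (List.Vector (Fin 3) m)).image (fun v => v.toList)).filter (fun z => List.IsChain (· ≠ ·) (z ++ z)), ((Finset.univ : Finset (Fin n)).filter (fun x => z.foldl (fun v c => μ c v) x = x ∧ z.foldl (fun v c => μ c v) ((z.take t).reverse.foldl (fun v c => μ c v) (μ d ((z.take t).foldl (fun v c => μ c v) x))) = (z.take t).reverse.foldl (fun v c => μ c v) (μ d ((z.take t).foldl (fun v c => μ c v) x)))).card) = ∑ z ∈ ((Finset.univ : Finset (List.Vector (Fin 3) m)).image (fun v => v.toList)).filter (fun z => List.IsChain (· ≠ ·) (z ++ z)), ((Finset.univ : Finset (Fin n)).filter (fun x => z.foldl (fun v c => μ c v) x = x ∧ z.foldl (fun v c => μ c v) (μ d x) = μ d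 x)).card :=
  fun _ μ hμ d _ _ ht => partnerMass_eq_edgeTwinMass μ hμ d ht

end Summit.MatrixMultiplication.MatrixMultiplication.Theorems.HyperoctahedralThreshold.Rotation
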